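import Summits.QuantumFields.YangMills.Theorems.UnitScaleTiltProp8FlatCubeSequenceAligned
import Summits.QuantumFields.YangMills.Theorems.UnitScaleTiltProp8FlatCubeOpsText
import HarnessLib

/-!
# Route `UnitScaleTilt`, crux K1 child «MinimiserStabilityRegPr» (stmt-QuantumFields-19200), v8 pillars P2/P5 — **THE ALIGNED CUBE SEQUENCE IS `Adm22`-ADMISSIBLE**:
# `R·M ≤ S ⇒ Adm22 (cubeSeqM x₀ k hk ρ S M hM) R M` ([Balaban1984PropagatorsII] (2.1)–(2.2) for the cube sequence (144) of [Balaban1985Variational]), hence P5's instance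
# `cubeSeqMT3 F n K x₀ ρ S M hM` meets the admissibility hypothesis of P2's text `FlatCubeOpsText.FlatOpsAdm(Pow)At` (OWNER RULING g21-№3 §A: «so that P5's instance is
# LITERALLY Adm22-admissible with M = L^{a₁}»)

Cell `ym3-torus` (HUMAN RULING D-0037, YM ladder rung R3), seat `ym3-torus-p1` gen 15.  `--supports stmt-QuantumFields-19200 --as helper`; count-neutral; def-free.
Inputs by name: `FlatCubeSequenceAligned.cubeSeqM_bigBlocks` ((2.1)) and `sep22_cubeSeqM` ((2.2) with `S + 1 ≤ dist`), p533572; `FlatCubeOpsText.Adm22`, p532698.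

References: [Balaban1984PropagatorsII] (2.1)–(2.2) p.224; [Balaban1985Variational] (144) p.300, (162)–(163) p.303.
-/

set_option autoImplicit false

namespace Summit.QuantumFields.YangMills.Theorems.FlatCubeSequenceAdm

open Literature.MathematicalPhysics.QuantumFieldTheory.Balaban1983to89
open T3ContinuumYM3Torus (T3Family)
open FlatCubeSequenceAligned (cubeSeqM cubeSeqMT3 cubeSeqM_bigBlocks sep22_cubeSeqM)
open FlatCubeOpsText (Adm22)

variable {P : Params}

/-- **THE ALIGNED CUBE SEQUENCE IS ADMISSIBLE**: for `R·M ≤ S` (and `1 ≤ M`, `k ≤ m + K`) the nested family `cubeSeqM x₀ k hk ρ S M hM` satisfies (2.1)–(2.2) with big blocks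
`M` and separation `R` — `FlatCubeOpsText.Adm22`. [cite: Balaban1984PropagatorsII, (2.1)-(2.2) p.224; Balaban1985Variational, (144) p.300] -/
theorem adm22_cubeSeqM (x₀ : Site P 0) {k : ℕ} (hk : k ≤ P.m + P.K) (ρ : ℕ) {S M R : ℕ} (hM : 1 ≤ M) (hRS : R * M ≤ S) :
    Adm22 (cubeSeqM x₀ k hk ρ S M hM) R M := by
  refine ⟨cubeSeqM_bigBlocks x₀ hk ρ S M hM, fun j y y' hy hy' => ?_⟩
  have h := sep22_cubeSeqM x₀ hk ρ S M hM j y y' hy hy'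
  have hcast : ((R * M : ℕ) : ℝ) ≤ (S : ℝ) := by exact_mod_cast hRS
  linarith

section T3

/-- **P5's INSTANCE MEETS P2's HYPOTHESIS**: at the d = 3 carrier (`k = K − n`), `R·M ≤ S ⇒ Adm22 (cubeSeqMT3 F n K x₀ ρ S M hM) R M` — with `M := L^{a₁}`, `R := R₁` of
[Balaban1985RegularSpaces] and `S := R₁·M₁` this is print's (144) «dist(□_{n+1}, □_nᶜ) = R₁M₁Lⁿη». [cite: Balaban1985Variational, (144) p.300; Balaban1984PropagatorsII, (2.2) p.224] -/
theorem adm22_cubeSeqMT3 (F : T3Family) (n K : ℕ) (x₀ : Site (F.P K) 0) (ρ : ℕ) {S M R : ℕ} (hM : 1 ≤ M) (hRS : R * M ≤ S) :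
    Adm22 (cubeSeqMT3 F n K x₀ ρ S M hM) R M :=
  adm22_cubeSeqM x₀ (FlatMinimizerH.le_T3 F n K) ρ hM hRS

end T3

end Summit.QuantumFields.YangMills.Theorems.FlatCubeSequenceAdm
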